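import Summits.Parity.GeneralizedHardyLittlewood.Theorems.PrimeLevelFamEdgeIdeaDeltasPeterssonLayersBands
import Literature.NumberTheory.LFunctions.HeckeLandauPageLowerBound
import HarnessLib

/-!
# Crux `MomentsBeyondDiagonal` (stmt-Parity-20007) — idea `bprz-gl1-twin-transfer`: crux-plan COMPANION (kernel, SORRY-FREE)
# Verdict of the crux-plan seat: **no-skeleton** (dead line as a LEVER) — see `Lines/bprz_gl1_twin_transfer_dead.md`.

Planner seat `cruxplan-stmt-Parity-20007-bprz-gl1-twin-transfer` (gen 0, zero kit), 2026-08-28. Idea card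
`Ideas/bprz-gl1-twin-transfer.md` 85d6f8ebfff575c4; triage TRIAGE-r1-1 (pass + sharpen) · TRIAGE-r1-2 v1.3 §P-T2-3 (pass → FAIL:
«rewrite the c = 1 layer via the two identities; then name the engine or return no-skeleton»).

FRAMING. The programme SEARCHES and TYPES. Summit NOT proved; K_A (`MomentsBeyondDiagonal`) neither proved nor refuted; nothing in
this file is a theorem about Landau–Siegel zeros; no `stub_*`, no `sorry`: this is NOT a registered skeleton line. It records, kernel-checked:

(1) the typed (A)-ATOM the card's located residual reduces to — `NoLowLyingZeros θ` (no zero of any non-principal Dirichlet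
    `L(s,χ)`, modulus `≤ Q^θ`, in the box `Re s ≥ 1 − C·log log Q/log Q`, `|Im s| ≤ (log Q)^B`, eventually in `Q`, for all `C, B`) and the
    card's own sums-form `MollifierCharSumBound θ` (restated verbatim from `IdeasR1I1Sketch.lean` l.162), with monotonicity in `θ`;
(2) the OFFERED STRENGTH RESHAPE of lens-17's heart stub `petersson_layers.stub_core : SubUpper ρ_c` as «atom → core», composed with the
    landed seven-piece glue into the crux BY NAME — `momentsBeyondDiagonal_of_atom` (sorry-free; its eight hypotheses are what a registered
    version would stub) — and the window bookkeeping `rhoCore_div_lt_fifth` (θ = 1/5 covers every core modulus on `(1, 31/30]`);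
(3) the REDUNDANCY CERTIFICATE that decides the verdict: `lOne_lb_of_noLowLyingZeros` — for every `θ > 0` the atom ALONE gives
    `‖L(1,χ)‖ ≥ c/log D` for every non-principal `χ mod D`, `D ≥ D₀` (Hecke–Landau, tree `heckeLandauPageLB_scale`), i.e. the route's target
    shape `Zhang2022.Skeleton.LOneLowerBound` at exponent 1 for all large moduli — strictly MORE than `Theorem1 = LOneLowerBound 2022` there —
    WITH NO MOMENT INPUT. Hence any skeleton of K_A whose (A)-bearing stub is a GL(1) atom of this kind is the costume of record
    (TRIAGE-r1-2 v1.2/v1.3; `Lines/exceptional_free_level_dichotomy_dead.md` §2(a)): `closes ∘ K_A ∘ stubs` factors through the atom.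

DESK FALSIFIER (1) (run before typing, independently of and concurring with P-T2-3 (a)): at `r = 1`,
`S(m₁n₁, m₂n₂; q) = S(1, m₁m₂n₁n₂; q)` (tree `kloostermanSum_eq_one_mul`, `KloostermanSectors.kloostermanSum_eq_inv_mul_sum_char₂`): the
layer depends on the four variables only through the product — lattice `{n₁n₂ − m₁m₂ = jq, |j| ≲ cZ²}`, GL(1) shadow = the root-number-twisted
NON-Hermitian moment `E_ψ[ε_ψ²(L·A)(ψ̄)²]`; BPRZ 2020 Thm 1.1 (Hermitian, lattice `am ≡ ±bn`) and Bettin–Chandee never receive an object. Details,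
the `1/D`-wash of the dispersion functionals, WHERE `D` ENTERS BY NAME, the engine census and the repair census: the `.md`.
-/

noncomputable section

open scoped MatrixGroups Real
open CongruenceSubgroup Complex Finset Polynomial MeasureTheory
open Literature.NumberTheory.EllipticCurves.ModularForms
open Literature.NumberTheory.LFunctions

namespace Summit.Parity.GeneralizedHardyLittlewood.Cruxes.MomentsBeyondDiagonal.BprzGl1TwinTransfer

open Summit.Parity.GeneralizedHardyLittlewood.Theses.PrimeLevelFamEdge
open Summit.Parity.GeneralizedHardyLittlewood.Theorems.PrimeLevelFamEdgeIdeaDeltas.PairsSplit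
  (FirstMomentBeyond SubFirst subFirst_of_momentsBeyondDiagonal)
open Summit.Parity.GeneralizedHardyLittlewood.Theorems.PrimeLevelFamEdgeIdeaDeltas.PeterssonLayers

/-! ## §1. The (A)-atom, in zeros form and in the card's sums form -/

/-- **`NoLowLyingZeros θ` — the (A)-ATOM of the core layers (WHERE `D` ENTERS, BY NAME).** For all `C, B`, eventually in the scale
`Q`: no NON-principal Dirichlet character `χ` to a modulus `D ≤ Q^θ` has an `L`-function zero `s` with `Re s ≥ 1 − C·log log Q / log Q` and
`|Im s| ≤ (log Q)^B`.  `D` := the modulus of a violating character; its real, `Im s = 0` instance is a Landau–Siegel zero `β_D` with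
`(1 − β_D)·log Q = O(log log Q)`.  Implied by GRH for Dirichlet `L`-functions; for `D ≤ (log Q)^{B'}` implied by Siegel's theorem and the
classical zero-free region; OPEN for `(log Q)^{B'} < D ≤ Q^θ` (Landau–Siegel-class, and slightly more: complex zeros in
`[c/(θ log Q), C log log Q/log Q]` are not excluded by log-free density either).  What the core `2 ≤ r ≤ q̂^{ρ_c}` of K_A consumes
(`.md` §D): in the layers `r ≡ 0 (mod D)` the sectors whose mod-`r` character is induced from `χ_D` carry Gauss weight
`cond·μ²/φ` with NO `1/cond` decay (tree `KloostermanSectors` Gauss-weight law), so their main terms — mollifier sums against `χ̄_D` —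
are `o(MAIN)` iff those sums are `o(√y/log y)` ⟸ this atom at `θ = ρ_c/Δ' < 1/5`; by the cell's record only the HEAD
`D ≤ r ≤ Z q^ε` is (A)-bearing (lens-7 E17-1a, lens-6 §v21a, TRIAGE-r1-2 v1.3 (s1) «the pin»), the tail being a single-sector
Parseval bound.  Tagged `@[conjecture]`: an OPEN statement of our theories, never a vendored fact. -/
@[conjecture] def NoLowLyingZeros (θ : ℝ) : Prop :=
  ∀ C B : ℝ, ∃ Q₀ : ℝ, ∀ Q : ℝ, Q₀ ≤ Q → ∀ (D : ℕ) [NeZero D] (χ : DirichletCharacter ℂ D),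
    χ ≠ 1 → (D : ℝ) ≤ Q ^ θ → ∀ s : ℂ, 1 - C * Real.log (Real.log Q) / Real.log Q ≤ s.re →
      |s.im| ≤ Real.log Q ^ B → DirichletCharacter.LFunction χ s ≠ 0

/-- **`MollifierCharSumBound θ`** — the card's located residual in SUMS form (restated VERBATIM from
`Cruxes/MomentsBeyondDiagonal/IdeasR1I1Sketch.lean` l.162; same normalised signature): eventually in `M`, every non-principal `χ` to a
modulus `r ≤ M^θ` has `|Σ_{m ≤ M} μ(m)χ(m) m^{−1/2}·log(M/m)/log M| ≤ ε √M/log M`.  (Weight `P = X` only; the core needs all admissible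
`P`, all lengths `y ∈ [√M, M]` and coprimality twists — which the zeros form delivers by the explicit formula; `.md` §D.)  OPEN; `@[conjecture]`. -/
@[conjecture] def MollifierCharSumBound (θ : ℝ) : Prop :=
  ∀ ε : ℝ, 0 < ε → ∃ M₀ : ℝ, ∀ M : ℝ, M₀ ≤ M → ∀ (r : ℕ) [NeZero r] (χ : DirichletCharacter ℂ r),
    χ ≠ 1 → (r : ℝ) ≤ M ^ θ →
      ‖∑ m ∈ Finset.Icc 1 ⌊M⌋₊, ((ArithmeticFunction.moebius m : ℤ) : ℂ) * χ (m : ZMod r) *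
          ((m : ℂ) ^ (-(1 / 2 : ℂ))) * ((Real.log (M / m) / Real.log M : ℝ) : ℂ)‖ ≤
        ε * Real.sqrt M / Real.log M

/-- Monotonicity (proved): the zeros-form atom for moduli `≤ Q^θ` gives it for moduli `≤ Q^{θ'}`, `θ' ≤ θ`. -/
theorem noLowLyingZeros_mono {θ θ' : ℝ} (hθ : θ' ≤ θ) : NoLowLyingZeros θ → NoLowLyingZeros θ' := by
  intro h C B
  obtain ⟨Q₀, hQ₀⟩ := h C B
  refine ⟨max Q₀ 1, fun Q hQ D _ χ hχ hD s hs him ↦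
    hQ₀ Q (le_trans (le_max_left _ _) hQ) D χ hχ ?_ s hs him⟩
  exact hD.trans (Real.rpow_le_rpow_of_exponent_le (le_trans (le_max_right _ _) hQ) hθ)

/-- Monotonicity (proved): the sums-form atom for moduli `≤ M^θ` gives it for moduli `≤ M^{θ'}`, `θ' ≤ θ`. -/
theorem mollifierCharSumBound_mono {θ θ' : ℝ} (hθ : θ' ≤ θ) :
    MollifierCharSumBound θ → MollifierCharSumBound θ' := by
  intro h ε hε
  obtain ⟨M₀, hM₀⟩ := h ε hε
  refine ⟨max M₀ 1, fun M hM r _ χ hχ hr ↦ hM₀ M (le_trans (le_max_left _ _) hM) r χ hχ ?_⟩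
  exact hr.trans (Real.rpow_le_rpow_of_exponent_le (le_trans (le_max_right _ _) hM) hθ)

/-! ## §2. Window bookkeeping: `θ = 1/5` covers every core modulus -/

/-- (proved) On the window `(1, 31/30]` the core cut satisfies `ρ_c(Δ')/Δ' < 1/5`: the core moduli `r ≤ q̂^{ρ_c(Δ')} = M^{ρ_c(Δ')/Δ'}`
(`M = q̂^{Δ'}`) lie below `M^{1/5}`; the pieces quantify `∃ Δ > 1` over windows, so a prover may shrink to this one. -/
theorem rhoCore_div_lt_fifth (Δ' : ℝ) (h₁ : 1 < Δ') (h₂ : Δ' ≤ 31 / 30) : rhoCore Δ' / Δ' < 1 / 5 := by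
  have hpos : 0 < Δ' := by linarith
  rw [div_lt_iff₀ hpos]
  unfold rhoCore
  nlinarith

/-- (proved) `ρ_c ≤ 1/5` on that window (`ρ_c(31/30) = 1/5`). -/
theorem rhoCore_le_fifth (Δ' : ℝ) (h₂ : Δ' ≤ 31 / 30) : rhoCore Δ' ≤ 1 / 5 := by
  unfold rhoCore
  linarith

/-! ## §3. The OFFERED strength reshape, composed into the crux BY NAME (sorry-free; nothing registered)

The eight hypotheses are exactly what a registered version would stub: FIRST · DIAG · RUNG (A-blind, OPEN, no engine of record) ·
«atom → CORE» (A-blind given the atom, OPEN) · BAND · IDENT · FAR (lens-17 v3 pieces, shared by name with `Lines/petersson_layers.lean`) ·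
the ATOM.  Not registered BY THIS SEAT because of §4: the atom alone already yields the route's target shape (costume of record). -/

/-- **`momentsBeyondDiagonal_of_atom` (proved glue):** the seven lens-17 pieces with the core supplied conditionally on the atom, plus
the atom, give `PrimeLevelFamEdge.MomentsBeyondDiagonal` — via the landed `MomentsBeyondDiagonal_of_sevenSplitBands`. -/
theorem momentsBeyondDiagonal_of_atom
    (h₁ : SubFirst) (h₂ : SubDiag) (h₃ : SubRung) (hC : NoLowLyingZeros (1 / 5) → SubUpper rhoCore)
    (h₅ : SubBand rhoCore rhoP) (h₆ : TailNearFar rhoP) (h₇ : SubFar rhoP) (hA : NoLowLyingZeros (1 / 5)) :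
    MomentsBeyondDiagonal :=
  MomentsBeyondDiagonal_of_sevenSplitBands h₁ h₂ h₃ (hC hA) h₅ h₆ h₇

/-- The same with the card's sums-form bridge (proved glue). -/
theorem momentsBeyondDiagonal_of_bridge
    (h₁ : SubFirst) (h₂ : SubDiag) (h₃ : SubRung) (hC : MollifierCharSumBound (1 / 5) → SubUpper rhoCore)
    (h₅ : SubBand rhoCore rhoP) (h₆ : TailNearFar rhoP) (h₇ : SubFar rhoP) (hB : MollifierCharSumBound (1 / 5)) :
    MomentsBeyondDiagonal :=
  MomentsBeyondDiagonal_of_sevenSplitBands h₁ h₂ h₃ (hC hB) h₅ h₆ h₇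

/-! ## §4. REDUNDANCY CERTIFICATE — the atom alone gives the route's target shape (Hecke–Landau) -/

/-- **`lOne_lb_of_noLowLyingZeros` (proved): for every `θ > 0`, `NoLowLyingZeros θ` ALONE gives `c/log D ≤ ‖L(1,χ)‖` for every
non-principal `χ mod D`, `D ≥ D₀`** — `Zhang2022.Skeleton.LOneLowerBound`-shape at exponent `1` for large moduli (the small moduli are
finitely many characters with `L(1,χ) ≠ 0`, Mathlib `DirichletCharacter.LFunction_apply_one_ne_zero`), hence `Theorem1 = LOneLowerBound 2022`
strength and more, with NO moment input.  Proof: at scale `Q = D^{1/θ}` the atom with `C = 1/θ`, `B = 0` clears the real segment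
`[1 − 1/log D, 1)` once `log log Q ≥ 1`; `heckeLandauPageLB_scale` (tree, proved) converts that to `c₂/log D ≤ ‖L(1,χ)‖`.
CONSEQUENCE (the verdict): a K_A-skeleton whose (A)-bearing stub is this atom makes `closes` redundant — costume of record. -/
theorem lOne_lb_of_noLowLyingZeros {θ : ℝ} (hθ : 0 < θ) (h : NoLowLyingZeros θ) :
    ∃ c : ℝ, 0 < c ∧ ∃ D₀ : ℝ, ∀ (D : ℕ) [NeZero D] (χ : DirichletCharacter ℂ D),
      χ ≠ 1 → D₀ ≤ (D : ℝ) → c / Real.log D ≤ ‖χ.LFunction 1‖ := by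
  obtain ⟨c₂, hc₂, H⟩ := heckeLandauPageLB_scale (η₀ := 1) one_pos
  obtain ⟨Q₀, hQ₀⟩ := h (1 / θ) 0
  -- the scale threshold K: Q ≥ K forces Q ≥ Q₀ and log log Q ≥ 1
  set K : ℝ := max (max Q₀ (Real.exp (Real.exp 1))) 1 with hK
  have hK1 : 1 ≤ K := le_max_right _ _
  have hK0 : 0 ≤ K := zero_le_one.trans hK1
  refine ⟨c₂, hc₂, max (K ^ θ) 3, fun D _ χ hχ hD ↦ ?_⟩
  have hD3r : (3 : ℝ) ≤ (D : ℝ) := le_trans (le_max_right _ _) hD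
  have hD3 : 3 ≤ D := by exact_mod_cast hD3r
  have hDpos : (0 : ℝ) < (D : ℝ) := by linarith
  have hlogD : 0 < Real.log (D : ℝ) := Real.log_pos (by linarith)
  -- the scale Q := D^{1/θ}
  set Q : ℝ := (D : ℝ) ^ (1 / θ) with hQdef
  have hθne : θ ≠ 0 := ne_of_gt hθ
  have hKQ : K ≤ Q := by
    have h1 : K ^ θ ≤ (D : ℝ) := le_trans (le_max_left _ _) hD
    have h2 : (K ^ θ) ^ (1 / θ) ≤ (D : ℝ) ^ (1 / θ) :=
      Real.rpow_le_rpow (Real.rpow_nonneg hK0 θ) h1 (by positivity)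
    have h3 : (K ^ θ) ^ (1 / θ) = K := by
      rw [← Real.rpow_mul hK0, mul_one_div_cancel hθne, Real.rpow_one]
    rw [h3] at h2
    exact h2
  have hQ₀Q : Q₀ ≤ Q := le_trans (le_trans (le_max_left _ _) (le_max_left _ _)) hKQ
  have hQee : Real.exp (Real.exp 1) ≤ Q := le_trans (le_trans (le_max_right _ _) (le_max_left _ _)) hKQ
  have hQpos : 0 < Q := lt_of_lt_of_le (Real.exp_pos _) hQee
  have hlogQ_ge : Real.exp 1 ≤ Real.log Q := by
    rw [Real.le_log_iff_exp_le hQpos]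
    exact hQee
  have hlogQpos : 0 < Real.log Q := lt_of_lt_of_le (Real.exp_pos _) hlogQ_ge
  have hloglogQ : 1 ≤ Real.log (Real.log Q) := by
    rw [Real.le_log_iff_exp_le hlogQpos]
    exact hlogQ_ge
  have hlogQ : Real.log Q = (1 / θ) * Real.log (D : ℝ) := by
    rw [hQdef, Real.log_rpow hDpos]
  -- D ≤ Q^θ
  have hDQ : (D : ℝ) ≤ Q ^ θ := by
    have : Q ^ θ = (D : ℝ) := by
      rw [hQdef, ← Real.rpow_mul hDpos.le, one_div_mul_cancel hθne, Real.rpow_one]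
    rw [this]
  -- zero-freeness of the real segment [1 - 1/log D, 1) from the atom
  have hfree : ∀ σ : ℝ, 1 - 1 / Real.log (D : ℝ) ≤ σ → σ < 1 → χ.LFunction (σ : ℂ) ≠ 0 := by
    intro σ hσ _
    refine hQ₀ Q hQ₀Q D χ hχ hDQ (σ : ℂ) ?_ ?_
    · -- 1 - (1/θ) log log Q / log Q ≤ σ
      have key : (1 / θ) * Real.log (Real.log Q) / Real.log Q = Real.log (Real.log Q) / Real.log (D : ℝ) := by
        rw [hlogQ]
        field_simp
      have hcmp : 1 / Real.log (D : ℝ) ≤ Real.log (Real.log Q) / Real.log (D : ℝ) := by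
        gcongr
      simp only [Complex.ofReal_re]
      rw [key]
      linarith
    · simp only [Complex.ofReal_im, abs_zero, Real.rpow_zero]
      norm_num
  have hmain := H D χ hD3 hχ (1 / Real.log (D : ℝ)) (by positivity)
    (by rw [one_div_mul_cancel (ne_of_gt hlogD)]) hfree
  -- c₂ * (1 / log D) ≤ ‖L(1,χ)‖
  rw [div_eq_mul_one_div]
  exact hmain

/-- The verdict's instance (proved): the atom this line's core would consume, `NoLowLyingZeros (1/5)`, already gives `c/log D ≤ ‖L(1,χ)‖`
for all large moduli. -/
theorem coreAtom_gives_lOne_lb (h : NoLowLyingZeros (1 / 5)) :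
    ∃ c : ℝ, 0 < c ∧ ∃ D₀ : ℝ, ∀ (D : ℕ) [NeZero D] (χ : DirichletCharacter ℂ D),
      χ ≠ 1 → D₀ ≤ (D : ℝ) → c / Real.log D ≤ ‖χ.LFunction 1‖ :=
  lOne_lb_of_noLowLyingZeros (by norm_num) h

end Summit.Parity.GeneralizedHardyLittlewood.Cruxes.MomentsBeyondDiagonal.BprzGl1TwinTransfer

end
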